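import Summits.HubbardSuperconductivity.HubbardSuperconductivity.Theorems.AnisotropyChordConcavityOneMagnonDip
import Literature.Combinatorics.SimpleGraph.LovaszThetaComplement
import Literature.Probability.LatticeModels.TorusBipartite

/-!
# Route `AnisotropyChord`: the monotone-transport conjectures `U_vt` / `M_Δ` TYPED, with proved links
# (definitions; bears on `Concavity` stmt-8150, `FerroSideChord` stmt-19089, `HalfFilledOrder` stmt-0906)

Typing authority: THEORY seat `hubbard-h0-rotor-theory-1` (rotor-class S-bridge, cycles 2–3,
2026-08-27; scratch names `VertexTransitiveSpinMonotone`, `TorusSpinMonotone`/`DeltaMonotoneCasimir`),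
restated here in the route's currency `Λ(ψ) = Re⟨ψ, S⁺_tot S⁻_tot ψ⟩` (equivalent to the `⟨𝐒²_tot⟩`
form within a sector: `OneMagnon.re_totalSpinSq_eq_condensate_add`).

* `VertexTransitiveCondensateMonotone` (**CONJECTURE U_vt**, open): on every finite connected
  VERTEX-TRANSITIVE simple graph, in every magnetisation sector, for `−1 ≤ Δ₁ ≤ Δ₂ ≤ 1`, the
  condensate of normalised sector ground states of `H(Δ) = xxzHamiltonian 1 G (−1) Δ` is non-decreasing
  from `Δ₁` to `Δ₂` ("switching on nearest-neighbour attraction between hard-core bosons on a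
  homogeneous graph never lowers the zero-momentum occupation").  The fixed-magnetisation, ground-state
  XXZ analogue of Dyson's HG2 monotonicity (1971, Problem 8); no quantum Griffiths inequality in print
  covers it (Benassi–Lees–Ueltschi 2016: products of `S¹`/`S²` only).  Evidence (theory seat, kit
  j269047–j272993 + local ED): 908 (graph, sector) cases on ≈260 vertex-transitive / regular graphs,
  0 violations.  The vertex-transitivity hypothesis CANNOT be dropped: `OneMagnon.not_graphGeneral_
  condensate_monotone` (13-vertex two-hub graph, kernel-checked), and the weighted-regular analogue
  fails numerically (two-lobe graphs, theory seat memo §17b).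
* `TorusCondensateMonotone` (**CONJECTURE M_Δ**, open; = U_vt on the square tori `torusGraph 2 L`):
  the instance the route needs.  `torusCondensateMonotone_of_vertexTransitive`: U_vt ⇒ M_Δ
  (`torusGraph_isVertexTransitive`: translations).
* `stub_monotoneFM_of_torusCondensateMonotone`: M_Δ ⇒ the registered stub `stub_monotoneFM` of the
  line `fm_monotone_anchor` on `FerroSideChord` (stmt-19089) — verbatim the same statement restricted
  to the half-filled sector and `Δ ∈ [0, 1]`.
* Companion proof file `…SpinMonotoneAttractiveSide`: M_Δ transports the tree's PROVED
  Kennedy–Lieb–Shastry anchor `SectorAnchorXY` (stmt-0977) from `Δ = 0` to every `Δ ∈ [0, 1]`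
  (half-filled planar order `Λ ≥ c·M⁴` on the whole attractive side, conditional on M_Δ only).

What this is NOT: no claim that U_vt / M_Δ hold; `Concavity` (stmt-8150) + the ferromagnetic ceiling
would imply M_Δ at half filling, and `OneMagnon.not_graphGeneral_condensate_concave` shows the
graph-general (CC) is false, so both conjectures genuinely need the torus' homogeneity.
-/

set_option linter.dupNamespace false

noncomputable section

namespace Summit.HubbardSuperconductivity.HubbardSuperconductivity.Theorems.AnisotropyChord

open Matrix Complex Finset
open Literature.MathematicalPhysics.QuantumLattice Literature.Probability.LatticeModels
open Literature.Combinatorics.SimpleGraph (IsVertexTransitive)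

/-- **CONJECTURE U_vt** (`VertexTransitiveSpinMonotone` of the theory seat, condensate form): on a
finite connected vertex-transitive simple graph, in every magnetisation sector `S^z_tot = M`, for
`−1 ≤ Δ₁ ≤ Δ₂ ≤ 1`, normalised sector ground states `ψ₁` of `H(Δ₁)` and `ψ₂` of `H(Δ₂)`
(`H(Δ) = xxzHamiltonian 1 G (−1) Δ`) satisfy `Λ(ψ₁) ≤ Λ(ψ₂)`.  OPEN; false without
vertex-transitivity (`OneMagnon.not_graphGeneral_condensate_monotone`). [conjecture: theory seat
hubbard-h0-rotor-theory-1, cycle 3, 2026-08-27] -/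
def VertexTransitiveCondensateMonotone : Prop :=
  ∀ (V : Type) [Fintype V] [DecidableEq V] (G : SimpleGraph V) [DecidableRel G.Adj],
    G.Connected → IsVertexTransitive G → ∀ (M Δ₁ Δ₂ : ℝ), -1 ≤ Δ₁ → Δ₁ ≤ Δ₂ → Δ₂ ≤ 1 →
      ∀ ψ₁ ψ₂ : TensorIndex V 2 → ℂ,
        ψ₁ ∈ spinZSector (Λ := V) 1 M → star ψ₁ ⬝ᵥ ψ₁ = 1 →
        xxzHamiltonian 1 G (-1) Δ₁ *ᵥ ψ₁ =
          ((lowestEnergyInSector 1 (xxzHamiltonian 1 G (-1) Δ₁) M : ℝ) : ℂ) • ψ₁ →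
        ψ₂ ∈ spinZSector (Λ := V) 1 M → star ψ₂ ⬝ᵥ ψ₂ = 1 →
        xxzHamiltonian 1 G (-1) Δ₂ *ᵥ ψ₂ =
          ((lowestEnergyInSector 1 (xxzHamiltonian 1 G (-1) Δ₂) M : ℝ) : ℂ) • ψ₂ →
        (star ψ₁ ⬝ᵥ (((∑ x, onSite x (spinRaise 1)) * (∑ y, onSite y (spinLower 1)) : Op V 2) *ᵥ ψ₁)).re
          ≤ (star ψ₂ ⬝ᵥ (((∑ x, onSite x (spinRaise 1)) * (∑ y, onSite y (spinLower 1)) : Op V 2) *ᵥ ψ₂)).re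

/-- **CONJECTURE M_Δ** (`TorusSpinMonotone` / `DeltaMonotoneCasimir` of the theory seat, condensate
form): U_vt on the square tori `(ℤ/Lℤ)²` — in every sector and for `−1 ≤ Δ₁ ≤ Δ₂ ≤ 1` the condensate
of normalised sector ground states of `xxzHamiltonian 1 (torusGraph 2 L) (−1) Δ` is non-decreasing
from `Δ₁` to `Δ₂`.  OPEN (ED: 22/22 torus cases incl. `8×8`, `N ≤ 4`; proved by the theory seat on
paper for the two-magnon sectors and near `Δ = 1`). [conjecture: theory seat hubbard-h0-rotor-theory-1,
cycles 2–3, 2026-08-27] -/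
def TorusCondensateMonotone : Prop :=
  ∀ (L : ℕ) [NeZero L] (M Δ₁ Δ₂ : ℝ), -1 ≤ Δ₁ → Δ₁ ≤ Δ₂ → Δ₂ ≤ 1 →
    ∀ ψ₁ ψ₂ : TensorIndex (TorusSite 2 L) 2 → ℂ,
      ψ₁ ∈ spinZSector (Λ := TorusSite 2 L) 1 M → star ψ₁ ⬝ᵥ ψ₁ = 1 →
        xxzHamiltonian 1 (torusGraph 2 L) (-1) Δ₁ *ᵥ ψ₁ =
          ((lowestEnergyInSector 1 (xxzHamiltonian 1 (torusGraph 2 L) (-1) Δ₁) M : ℝ) : ℂ) • ψ₁ →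
      ψ₂ ∈ spinZSector (Λ := TorusSite 2 L) 1 M → star ψ₂ ⬝ᵥ ψ₂ = 1 →
        xxzHamiltonian 1 (torusGraph 2 L) (-1) Δ₂ *ᵥ ψ₂ =
          ((lowestEnergyInSector 1 (xxzHamiltonian 1 (torusGraph 2 L) (-1) Δ₂) M : ℝ) : ℂ) • ψ₂ →
      (star ψ₁ ⬝ᵥ (((∑ x, onSite x (spinRaise 1)) * (∑ y, onSite y (spinLower 1)) : Op (TorusSite 2 L) 2) *ᵥ ψ₁)).re
        ≤ (star ψ₂ ⬝ᵥ (((∑ x, onSite x (spinRaise 1)) * (∑ y, onSite y (spinLower 1)) : Op (TorusSite 2 L) 2) *ᵥ ψ₂)).re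

/-- Translations are automorphisms of the discrete torus, so `torusGraph d L` is vertex-transitive.
[folklore] -/
theorem torusGraph_isVertexTransitive (d L : ℕ) : IsVertexTransitive (torusGraph d L) := by
  intro x y
  refine ⟨{ toEquiv := Equiv.addRight (y - x), map_rel_iff' := ?_ }, ?_⟩
  · intro a b
    simp only [Equiv.coe_addRight, torusGraph]
    exact SimpleGraph.circulantGraph_adj_translate
  · show x + (y - x) = y
    abel

/-- **U_vt ⇒ M_Δ**: the square torus is connected and vertex-transitive. [folklore] -/
theorem torusCondensateMonotone_of_vertexTransitive (h : VertexTransitiveCondensateMonotone) :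
    TorusCondensateMonotone := by
  intro L _ M Δ₁ Δ₂ h1 h12 h2 ψ₁ ψ₂ g1m g1n g1e g2m g2n g2e
  exact h (TorusSite 2 L) (torusGraph 2 L) (torusGraph_connected_of_proj 2 L)
    (torusGraph_isVertexTransitive 2 L) M Δ₁ Δ₂ h1 h12 h2 ψ₁ ψ₂ g1m g1n g1e g2m g2n g2e

/-- **M_Δ ⇒ the registered stub `stub_monotoneFM`** of the crux line `fm_monotone_anchor` on
`FerroSideChord` (stmt-19089; "Griffiths-II monotonicity in the ferromagnetic Ising coupling on
`[0,1]`", half-filled sector, even `M ≥ 4`): that stub is literally `TorusCondensateMonotone`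
restricted to `S^z_tot = 0` and `0 ≤ Δ₁ ≤ Δ₂ ≤ 1` (statement copied verbatim from the registered
skeleton).  So the theory seat's M_Δ and the route's first FM-side stub are the same open problem,
and `OneMagnon.not_graphGeneral_condensate_monotone` applies to both: no graph-blind argument can
prove it. [folklore] -/
theorem stub_monotoneFM_of_torusCondensateMonotone (h : TorusCondensateMonotone) :
    ∀ (M : ℕ) [NeZero M], Even M → 4 ≤ M → ∀ (Δ₁ Δ₂ : ℝ), 0 ≤ Δ₁ → Δ₁ ≤ Δ₂ → Δ₂ ≤ 1 → ∀ (ψ₁ ψ₂ : Literature.MathematicalPhysics.QuantumLattice.TensorIndex (Literature.Probability.LatticeModels.TorusSite 2 M) 2 → ℂ), ψ₁ ∈ Literature.MathematicalPhysics.QuantumLattice.spinZSector (Λ := Literature.Probability.LatticeModels.TorusSite 2 M) 1 0 → star ψ₁ ⬝ᵥ ψ₁ = 1 → Matrix.mulVec (Literature.MathematicalPhysics.QuantumLattice.xxzHamiltonian 1 (Literature.Probability.LatticeModels.torusGraph 2 M) (-1) Δ₁) ψ₁ = ((Literature.MathematicalPhysics.QuantumLattice.lowestEnergyInSector 1 (Literature.MathematicalPhysics.QuantumLattice.xxzHamiltonian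 1 (Literature.Probability.LatticeModels.torusGraph 2 M) (-1) Δ₁) 0 : ℝ) : ℂ) • ψ₁ → ψ₂ ∈ Literature.MathematicalPhysics.QuantumLattice.spinZSector (Λ := Literature.Probability.LatticeModels.TorusSite 2 M) 1 0 → star ψ₂ ⬝ᵥ ψ₂ = 1 → Matrix.mulVec (Literature.MathematicalPhysics.QuantumLattice.xxzHamiltonian 1 (Literature.Probability.LatticeModels.torusGraph 2 M) (-1) Δ₂) ψ₂ = ((Literature.MathematicalPhysics.QuantumLattice.lowestEnergyInSector 1 (Literature.MathematicalPhysics.QuantumLattice.xxzHamiltonian 1 (Literature.Probability.LatticeModels.torusGraph 2 M) (-1) Δ₂) 0 : ℝ) : ℂ) • ψ₂ → (star ψ₁ ⬝ᵥ Matrix.mulVec ((∑ x : Literature.Probability.LatticeModels.TorusSite 2 M, Literature.MathematicalPhysics.QuantumLattice.onSite x (Literature.MathematicalPhysics.QuantumLattice.spinRaise 1)) * (∑ y : Literature.Probability.LatticeModels.TorusSite 2 M, Literature.MathematicalPhysics.QuantumLattice.onSite y (Literature.MathematicalPhysics.QuantumLattice.spinLower 1))) ψ₁).re ≤ (star ψ₂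 ⬝ᵥ Matrix.mulVec ((∑ x : Literature.Probability.LatticeModels.TorusSite 2 M, Literature.MathematicalPhysics.QuantumLattice.onSite x (Literature.MathematicalPhysics.QuantumLattice.spinRaise 1)) * (∑ y : Literature.Probability.LatticeModels.TorusSite 2 M, Literature.MathematicalPhysics.QuantumLattice.onSite y (Literature.MathematicalPhysics.QuantumLattice.spinLower 1))) ψ₂).re := by
  intro M _ _ hM Δ₁ Δ₂ h1 h12 h2 ψ₁ ψ₂ g1m g1n g1e g2m g2n g2e
  exact h M 0 Δ₁ Δ₂ (by linarith) h12 h2 ψ₁ ψ₂ g1m g1n g1e g2m g2n g2e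


/-! ### Sector slices of U_vt named by the theory seat in cycle 4 (typed rungs)

`VertexTransitiveCondensateMonotone` quantifies over every sector `M`; the theory seat
(`hubbard-h0-rotor-theory-1`, cycle 4, `Sketch4.lean`) works on two slices under their own names:
the two-magnon rung TM-VT (`M = |V|/2 − 2`) and the half-filling rung (`M = 0`).  Status in the tree:
the ONE-magnon slice `M = |V|/2 − 1` is PROVED (`OneMagnon.vertexTransitive_oneMagnon_slice`, file
`…SpinMonotoneOneMagnonVT`: `Λ ≡ 2|V| − 2`); in the two-magnon slice the CONCAVITY analogue is FALSE
on `C₇` (`TwoMagnon.not_vertexTransitive_condensate_concave`, file `…ConcavityCycleSeven`) while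
monotonicity has no counterexample (theory seat: 0 violations in ≈ 1 250 vertex-transitive
evaluations, proved on paper for graphs with a single contact orbit). -/

/-- **Rung TM-VT** (`TwoMagnonVTSpinMonotone` of the theory seat, condensate currency): the
two-magnon slice `S^z_tot = |V|/2 − 2` of `VertexTransitiveCondensateMonotone`.  OPEN.
[conjecture: theory seat hubbard-h0-rotor-theory-1, cycle 4, 2026-08-27] -/
def TwoMagnonVTCondensateMonotone : Prop :=
  ∀ (V : Type) [Fintype V] [DecidableEq V] (G : SimpleGraph V) [DecidableRel G.Adj],
    G.Connected → IsVertexTransitive G → ∀ (Δ₁ Δ₂ : ℝ), -1 ≤ Δ₁ → Δ₁ ≤ Δ₂ → Δ₂ ≤ 1 →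
      ∀ ψ₁ ψ₂ : TensorIndex V 2 → ℂ,
        ψ₁ ∈ spinZSector (Λ := V) 1 ((Fintype.card V : ℝ) / 2 - 2) → star ψ₁ ⬝ᵥ ψ₁ = 1 →
        xxzHamiltonian 1 G (-1) Δ₁ *ᵥ ψ₁ =
          ((lowestEnergyInSector 1 (xxzHamiltonian 1 G (-1) Δ₁) ((Fintype.card V : ℝ) / 2 - 2) : ℝ) : ℂ) • ψ₁ →
        ψ₂ ∈ spinZSector (Λ := V) 1 ((Fintype.card V : ℝ) / 2 - 2) → star ψ₂ ⬝ᵥ ψ₂ = 1 →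
        xxzHamiltonian 1 G (-1) Δ₂ *ᵥ ψ₂ =
          ((lowestEnergyInSector 1 (xxzHamiltonian 1 G (-1) Δ₂) ((Fintype.card V : ℝ) / 2 - 2) : ℝ) : ℂ) • ψ₂ →
        (star ψ₁ ⬝ᵥ (((∑ x, onSite x (spinRaise 1)) * (∑ y, onSite y (spinLower 1)) : Op V 2) *ᵥ ψ₁)).re
          ≤ (star ψ₂ ⬝ᵥ (((∑ x, onSite x (spinRaise 1)) * (∑ y, onSite y (spinLower 1)) : Op V 2) *ᵥ ψ₂)).re

/-- **Half-filling rung** (`HalfFillingVTSpinMonotone` of the theory seat, condensate currency): the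
slice `S^z_tot = 0` of `VertexTransitiveCondensateMonotone` (hard-core bosons at half filling; on the
square torus `torusGraph 2 M`, `M` even, and `0 ≤ Δ₁` this is the registered stub `stub_monotoneFM` of
`FerroSideChord`, cf. `stub_monotoneFM_of_torusCondensateMonotone`).  OPEN.
[conjecture: theory seat hubbard-h0-rotor-theory-1, cycle 4, 2026-08-27] -/
def HalfFillingVTCondensateMonotone : Prop :=
  ∀ (V : Type) [Fintype V] [DecidableEq V] (G : SimpleGraph V) [DecidableRel G.Adj],
    G.Connected → IsVertexTransitive G → ∀ (Δ₁ Δ₂ : ℝ), -1 ≤ Δ₁ → Δ₁ ≤ Δ₂ → Δ₂ ≤ 1 →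
      ∀ ψ₁ ψ₂ : TensorIndex V 2 → ℂ,
        ψ₁ ∈ spinZSector (Λ := V) 1 0 → star ψ₁ ⬝ᵥ ψ₁ = 1 →
        xxzHamiltonian 1 G (-1) Δ₁ *ᵥ ψ₁ =
          ((lowestEnergyInSector 1 (xxzHamiltonian 1 G (-1) Δ₁) 0 : ℝ) : ℂ) • ψ₁ →
        ψ₂ ∈ spinZSector (Λ := V) 1 0 → star ψ₂ ⬝ᵥ ψ₂ = 1 →
        xxzHamiltonian 1 G (-1) Δ₂ *ᵥ ψ₂ =
          ((lowestEnergyInSector 1 (xxzHamiltonian 1 G (-1) Δ₂) 0 : ℝ) : ℂ) • ψ₂ →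
        (star ψ₁ ⬝ᵥ (((∑ x, onSite x (spinRaise 1)) * (∑ y, onSite y (spinLower 1)) : Op V 2) *ᵥ ψ₁)).re
          ≤ (star ψ₂ ⬝ᵥ (((∑ x, onSite x (spinRaise 1)) * (∑ y, onSite y (spinLower 1)) : Op V 2) *ᵥ ψ₂)).re

/-- U_vt ⇒ the two-magnon rung TM-VT (a sector slice). [folklore] -/
theorem twoMagnonVT_of_vertexTransitive (h : VertexTransitiveCondensateMonotone) :
    TwoMagnonVTCondensateMonotone :=
  fun V _ _ G _ hc hvt Δ₁ Δ₂ h1 h12 h2 => h V G hc hvt _ Δ₁ Δ₂ h1 h12 h2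

/-- U_vt ⇒ the half-filling rung (a sector slice). [folklore] -/
theorem halfFillingVT_of_vertexTransitive (h : VertexTransitiveCondensateMonotone) :
    HalfFillingVTCondensateMonotone :=
  fun V _ _ G _ hc hvt Δ₁ Δ₂ h1 h12 h2 => h V G hc hvt 0 Δ₁ Δ₂ h1 h12 h2

/-- The half-filling rung ⇒ the registered stub `stub_monotoneFM` of `FerroSideChord` (stmt-19089),
through the torus (connected, vertex-transitive). [folklore] -/
theorem stub_monotoneFM_of_halfFillingVT (h : HalfFillingVTCondensateMonotone) :
    ∀ (M : ℕ) [NeZero M], Even M → 4 ≤ M → ∀ (Δ₁ Δ₂ : ℝ), 0 ≤ Δ₁ → Δ₁ ≤ Δ₂ → Δ₂ ≤ 1 → ∀ (ψ₁ ψ₂ : Literature.MathematicalPhysics.QuantumLattice.TensorIndex (Literature.Probability.LatticeModels.TorusSite 2 M) 2 → ℂ), ψ₁ ∈ Literature.MathematicalPhysics.QuantumLattice.spinZSector (Λ := Literature.Probability.LatticeModels.TorusSite 2 M) 1 0 → star ψ₁ ⬝ᵥ ψ₁ = 1 → Matrix.mulVec (Literature.MathematicalPhysics.QuantumLattice.xxzHamiltonian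 1 (Literature.Probability.LatticeModels.torusGraph 2 M) (-1) Δ₁) ψ₁ = ((Literature.MathematicalPhysics.QuantumLattice.lowestEnergyInSector 1 (Literature.MathematicalPhysics.QuantumLattice.xxzHamiltonian 1 (Literature.Probability.LatticeModels.torusGraph 2 M) (-1) Δ₁) 0 : ℝ) : ℂ) • ψ₁ → ψ₂ ∈ Literature.MathematicalPhysics.QuantumLattice.spinZSector (Λ := Literature.Probability.LatticeModels.TorusSite 2 M) 1 0 → star ψ₂ ⬝ᵥ ψ₂ = 1 → Matrix.mulVec (Literature.MathematicalPhysics.QuantumLattice.xxzHamiltonian 1 (Literature.Probability.LatticeModels.torusGraph 2 M) (-1) Δ₂) ψ₂ = ((Literature.MathematicalPhysics.QuantumLattice.lowestEnergyInSector 1 (Literature.MathematicalPhysics.QuantumLattice.xxzHamiltonian 1 (Literature.Probability.LatticeModels.torusGraph 2 M) (-1) Δ₂) 0 : ℝ) : ℂ) • ψ₂ → (star ψ₁ ⬝ᵥ Matrix.mulVec ((∑ x : Literature.Probability.LatticeModels.TorusSite 2 M, Literature.MathematicalPhysics.QuantumLattice.onSite x (Literature.MathematicalPhysics.QuantumLattice.spinRaise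 1)) * (∑ y : Literature.Probability.LatticeModels.TorusSite 2 M, Literature.MathematicalPhysics.QuantumLattice.onSite y (Literature.MathematicalPhysics.QuantumLattice.spinLower 1))) ψ₁).re ≤ (star ψ₂ ⬝ᵥ Matrix.mulVec ((∑ x : Literature.Probability.LatticeModels.TorusSite 2 M, Literature.MathematicalPhysics.QuantumLattice.onSite x (Literature.MathematicalPhysics.QuantumLattice.spinRaise 1)) * (∑ y : Literature.Probability.LatticeModels.TorusSite 2 M, Literature.MathematicalPhysics.QuantumLattice.onSite y (Literature.MathematicalPhysics.QuantumLattice.spinLower 1))) ψ₂).re := by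
  intro M _ _ hM Δ₁ Δ₂ h1 h12 h2 ψ₁ ψ₂ g1m g1n g1e g2m g2n g2e
  exact h (TorusSite 2 M) (torusGraph 2 M) (torusGraph_connected_of_proj 2 M)
    (torusGraph_isVertexTransitive 2 M) Δ₁ Δ₂ (by linarith) h12 h2 ψ₁ ψ₂ g1m g1n g1e g2m g2n g2e


/-! ### The total-positivity layer of the theory seat's cycle 6 (typed conjectures of record)

THEORY seat `hubbard-h0-rotor-theory-1`, cycle 6 (memo ROTOR-THEORY-6 §48–§57, `Sketch6.lean`), widens
`U_vt` from the single observable `S⁺_tot S⁻_tot` to the GEOMETRY OF THE GROUND-STATE CURVE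
`Δ ↦ ψ_M(Δ)` of a sector: its Gram kernel `|⟨ψ_M(Δ), ψ_M(Δ')⟩|` is conjectured TOTALLY POSITIVE on
vertex-transitive graphs (TP-VT), which contains ground-state overlap monotonicity (OM); the TOWER
order parameter `|⟨ψ_M, S⁺_tot ψ_{M−1}⟩|` is conjectured monotone (TO); and the frozen-condensate form
(Λ₂[S⁺S⁻]) is the integrated version of `U_vt`.  Evidence (theory seat, local ED): TP₂ ∧ TP₃ with
0 negative minors on 15 vertex-transitive graphs / 52 (graph, sector) cases incl. `4×4`, W = 2,3,5,8;
(TO) 0 violations on 19 vertex-transitive graphs; all FALSE on lobe-switch graphs (`K_{1,7}+K_5`).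
STATUS IN THE TREE: the W = 2 one-contact-orbit case of TP-VT and (OM) is PROVED on every connected
vertex- and edge-transitive graph for all `Δ ≤ 1` (`TwoMagnon.twoMagnon_gramTP2_of_edgeTransitive`,
`TwoMagnon.twoMagnon_overlapMonotone_of_edgeTransitive`, file `…SpinMonotoneTwoMagnonGramTP`, via
LEMMA TP₂ `cauchyGram_minor_nonneg` of `…ResolventGramTP`).  The general tower-cone conjecture (Λ₂)
of the memo (arbitrary words in `S^±_tot`) is not typed here (it needs a word datatype). -/

/-- **CONJECTURE (OM)** (`VertexTransitiveOverlapMonotone` of the theory seat) — ground-state overlap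
monotonicity: on a finite connected vertex-transitive graph, in every sector `S^z_tot = M`, for
`−1 ≤ Δ₁ ≤ Δ₁' ≤ Δ₂ ≤ 1` and normalised sector ground states `ψ₁` of `H(Δ₁)`, `ψ₁'` of `H(Δ₁')`, `φ`
of `H(Δ₂)` (`H(Δ) = xxzHamiltonian 1 G (−1) Δ`): `|⟨ψ₁, φ⟩| ≤ |⟨ψ₁', φ⟩|`.  OPEN in general; PROVED
for the two-magnon sector of edge-transitive graphs (`TwoMagnon.twoMagnon_overlapMonotone_of_
edgeTransitive`); NOT a property of general stoquastic pencils (theory seat memo §51: 4/480 random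
counterexamples). [conjecture: theory seat hubbard-h0-rotor-theory-1, cycle 6, 2026-08-27] -/
def VertexTransitiveOverlapMonotone : Prop :=
  ∀ (V : Type) [Fintype V] [DecidableEq V] (G : SimpleGraph V) [DecidableRel G.Adj],
    G.Connected → IsVertexTransitive G → ∀ (M Δ₁ Δ₁' Δ₂ : ℝ),
      -1 ≤ Δ₁ → Δ₁ ≤ Δ₁' → Δ₁' ≤ Δ₂ → Δ₂ ≤ 1 →
      ∀ ψ₁ ψ₁' φ : TensorIndex V 2 → ℂ,
        ψ₁ ∈ spinZSector (Λ := V) 1 M → star ψ₁ ⬝ᵥ ψ₁ = 1 →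
        xxzHamiltonian 1 G (-1) Δ₁ *ᵥ ψ₁ =
          ((lowestEnergyInSector 1 (xxzHamiltonian 1 G (-1) Δ₁) M : ℝ) : ℂ) • ψ₁ →
        ψ₁' ∈ spinZSector (Λ := V) 1 M → star ψ₁' ⬝ᵥ ψ₁' = 1 →
        xxzHamiltonian 1 G (-1) Δ₁' *ᵥ ψ₁' =
          ((lowestEnergyInSector 1 (xxzHamiltonian 1 G (-1) Δ₁') M : ℝ) : ℂ) • ψ₁' →
        φ ∈ spinZSector (Λ := V) 1 M → star φ ⬝ᵥ φ = 1 →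
        xxzHamiltonian 1 G (-1) Δ₂ *ᵥ φ =
          ((lowestEnergyInSector 1 (xxzHamiltonian 1 G (-1) Δ₂) M : ℝ) : ℂ) • φ →
        ‖star ψ₁ ⬝ᵥ φ‖ ≤ ‖star ψ₁' ⬝ᵥ φ‖

/-- **CONJECTURE TP-VT** (`VertexTransitiveGroundStateGramTP2` of the theory seat) — TOTAL
POSITIVITY (order 2) of the ground-state Gram kernel: on a finite connected vertex-transitive graph,
in every sector `S^z_tot = M`, for rows `−1 ≤ Δ₁ ≤ Δ₂ ≤ 1` and columns `−1 ≤ Δ₃ ≤ Δ₄ ≤ 1` and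
normalised sector ground states `ψᵢ` of `H(Δᵢ)`:
`|⟨ψ₁, ψ₄⟩| |⟨ψ₂, ψ₃⟩| ≤ |⟨ψ₁, ψ₃⟩| |⟨ψ₂, ψ₄⟩|`.  OPEN in general (ED: all 44 100 TP₂ and 1 768 900
TP₃ minors of a 21-point grid non-negative on `4×4`, W = 2,3,5,8, and on 14 further vertex-transitive
graphs; FALSE on lobe-switch graphs and for 4/135 random stoquastic pencils); PROVED for the
two-magnon sector of edge-transitive graphs, all `Δ ≤ 1` (`TwoMagnon.twoMagnon_gramTP2_of_
edgeTransitive`: there the curve is a resolvent curve in the first spectral gap and LEMMA TP₂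
applies).  Probabilistic reading (memo §52, §57): contact times before and after the seam of the
two-sided ground-state bridge are positively correlated; Griffiths form (G₂).
[conjecture: theory seat hubbard-h0-rotor-theory-1, cycle 6, 2026-08-27] -/
def VertexTransitiveGroundStateGramTP2 : Prop :=
  ∀ (V : Type) [Fintype V] [DecidableEq V] (G : SimpleGraph V) [DecidableRel G.Adj],
    G.Connected → IsVertexTransitive G → ∀ (M Δ₁ Δ₂ Δ₃ Δ₄ : ℝ),
      -1 ≤ Δ₁ → Δ₁ ≤ Δ₂ → Δ₂ ≤ 1 → -1 ≤ Δ₃ → Δ₃ ≤ Δ₄ → Δ₄ ≤ 1 →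
      ∀ ψ₁ ψ₂ ψ₃ ψ₄ : TensorIndex V 2 → ℂ,
        ψ₁ ∈ spinZSector (Λ := V) 1 M → star ψ₁ ⬝ᵥ ψ₁ = 1 →
        xxzHamiltonian 1 G (-1) Δ₁ *ᵥ ψ₁ =
          ((lowestEnergyInSector 1 (xxzHamiltonian 1 G (-1) Δ₁) M : ℝ) : ℂ) • ψ₁ →
        ψ₂ ∈ spinZSector (Λ := V) 1 M → star ψ₂ ⬝ᵥ ψ₂ = 1 →
        xxzHamiltonian 1 G (-1) Δ₂ *ᵥ ψ₂ =
          ((lowestEnergyInSector 1 (xxzHamiltonian 1 G (-1) Δ₂) M : ℝ) : ℂ) • ψ₂ →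
        ψ₃ ∈ spinZSector (Λ := V) 1 M → star ψ₃ ⬝ᵥ ψ₃ = 1 →
        xxzHamiltonian 1 G (-1) Δ₃ *ᵥ ψ₃ =
          ((lowestEnergyInSector 1 (xxzHamiltonian 1 G (-1) Δ₃) M : ℝ) : ℂ) • ψ₃ →
        ψ₄ ∈ spinZSector (Λ := V) 1 M → star ψ₄ ⬝ᵥ ψ₄ = 1 →
        xxzHamiltonian 1 G (-1) Δ₄ *ᵥ ψ₄ =
          ((lowestEnergyInSector 1 (xxzHamiltonian 1 G (-1) Δ₄) M : ℝ) : ℂ) • ψ₄ →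
        ‖star ψ₁ ⬝ᵥ ψ₄‖ * ‖star ψ₂ ⬝ᵥ ψ₃‖ ≤ ‖star ψ₁ ⬝ᵥ ψ₃‖ * ‖star ψ₂ ⬝ᵥ ψ₄‖

/-- **CONJECTURE (TO)** (`VertexTransitiveTowerOverlapMonotone` of the theory seat) — monotonicity of
the TOWER ORDER PARAMETER: on a finite connected vertex-transitive graph, for `−1 ≤ Δ₁ ≤ Δ₂ ≤ 1`,
normalised sector ground states `ψᵢ` (sector `M`) and `φᵢ` (sector `M − 1`) of `H(Δᵢ)`:
`|⟨ψ₁, S⁺_tot φ₁⟩| ≤ |⟨ψ₂, S⁺_tot φ₂⟩|`, `S⁺_tot = Σ_x S⁺_x` (the transition element of the planar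
order parameter between adjacent sector ground states).  OPEN (ED: 0 violations on 19
vertex-transitive graphs, all sectors; FALSE on lobe-switch graphs, 17 violations, worst `2.4e-2`).
By the tower transition identity (`towerTransition_identity`, file `…TowerIntertwining`)
`(E_M − E_{M−1})⟨ψ, S⁺_tot φ⟩ = (1−Δ)⟨ψ, Σ_xΣ_{y∼x} S⁺_xSᶻ_y φ⟩`.
[conjecture: theory seat hubbard-h0-rotor-theory-1, cycle 6, 2026-08-27] -/
def VertexTransitiveTowerOverlapMonotone : Prop :=
  ∀ (V : Type) [Fintype V] [DecidableEq V] (G : SimpleGraph V) [DecidableRel G.Adj],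
    G.Connected → IsVertexTransitive G → ∀ (M Δ₁ Δ₂ : ℝ), -1 ≤ Δ₁ → Δ₁ ≤ Δ₂ → Δ₂ ≤ 1 →
      ∀ ψ₁ φ₁ ψ₂ φ₂ : TensorIndex V 2 → ℂ,
        ψ₁ ∈ spinZSector (Λ := V) 1 M → star ψ₁ ⬝ᵥ ψ₁ = 1 →
        xxzHamiltonian 1 G (-1) Δ₁ *ᵥ ψ₁ =
          ((lowestEnergyInSector 1 (xxzHamiltonian 1 G (-1) Δ₁) M : ℝ) : ℂ) • ψ₁ →
        φ₁ ∈ spinZSector (Λ := V) 1 (M - 1) → star φ₁ ⬝ᵥ φ₁ = 1 →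
        xxzHamiltonian 1 G (-1) Δ₁ *ᵥ φ₁ =
          ((lowestEnergyInSector 1 (xxzHamiltonian 1 G (-1) Δ₁) (M - 1) : ℝ) : ℂ) • φ₁ →
        ψ₂ ∈ spinZSector (Λ := V) 1 M → star ψ₂ ⬝ᵥ ψ₂ = 1 →
        xxzHamiltonian 1 G (-1) Δ₂ *ᵥ ψ₂ =
          ((lowestEnergyInSector 1 (xxzHamiltonian 1 G (-1) Δ₂) M : ℝ) : ℂ) • ψ₂ →
        φ₂ ∈ spinZSector (Λ := V) 1 (M - 1) → star φ₂ ⬝ᵥ φ₂ = 1 →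
        xxzHamiltonian 1 G (-1) Δ₂ *ᵥ φ₂ =
          ((lowestEnergyInSector 1 (xxzHamiltonian 1 G (-1) Δ₂) (M - 1) : ℝ) : ℂ) • φ₂ →
        ‖star ψ₁ ⬝ᵥ ((∑ x, onSite x (spinRaise 1) : Op V 2) *ᵥ φ₁)‖ ≤
          ‖star ψ₂ ⬝ᵥ ((∑ x, onSite x (spinRaise 1) : Op V 2) *ᵥ φ₂)‖

/-- **CONJECTURE (Λ₂[S⁺S⁻])** (`VertexTransitiveFrozenCondensateMonotone` of the theory seat) —
frozen-condensate monotonicity: on a finite connected vertex-transitive graph, in every sector, for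
`−1 ≤ Δ₁ ≤ Δ₁' ≤ Δ₂ ≤ 1` and normalised sector ground states `ψ₁, ψ₁', φ` of `H(Δ₁), H(Δ₁'), H(Δ₂)`:
`|⟨ψ₁, S⁺_tot S⁻_tot φ⟩| ≤ |⟨ψ₁', S⁺_tot S⁻_tot φ⟩|` — the overlap with the FROZEN condensate vector
taken at the larger anisotropy is non-decreasing.  Its infinitesimal form at `Δ₁' = Δ₂` is `U_vt`
(`VertexTransitiveCondensateMonotone`).  OPEN (ED: part of the 0/540 tower-cone census, memo §50).
[conjecture: theory seat hubbard-h0-rotor-theory-1, cycle 6, 2026-08-27] -/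
def VertexTransitiveFrozenCondensateMonotone : Prop :=
  ∀ (V : Type) [Fintype V] [DecidableEq V] (G : SimpleGraph V) [DecidableRel G.Adj],
    G.Connected → IsVertexTransitive G → ∀ (M Δ₁ Δ₁' Δ₂ : ℝ),
      -1 ≤ Δ₁ → Δ₁ ≤ Δ₁' → Δ₁' ≤ Δ₂ → Δ₂ ≤ 1 →
      ∀ ψ₁ ψ₁' φ : TensorIndex V 2 → ℂ,
        ψ₁ ∈ spinZSector (Λ := V) 1 M → star ψ₁ ⬝ᵥ ψ₁ = 1 →
        xxzHamiltonian 1 G (-1) Δ₁ *ᵥ ψ₁ =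
          ((lowestEnergyInSector 1 (xxzHamiltonian 1 G (-1) Δ₁) M : ℝ) : ℂ) • ψ₁ →
        ψ₁' ∈ spinZSector (Λ := V) 1 M → star ψ₁' ⬝ᵥ ψ₁' = 1 →
        xxzHamiltonian 1 G (-1) Δ₁' *ᵥ ψ₁' =
          ((lowestEnergyInSector 1 (xxzHamiltonian 1 G (-1) Δ₁') M : ℝ) : ℂ) • ψ₁' →
        φ ∈ spinZSector (Λ := V) 1 M → star φ ⬝ᵥ φ = 1 →
        xxzHamiltonian 1 G (-1) Δ₂ *ᵥ φ =
          ((lowestEnergyInSector 1 (xxzHamiltonian 1 G (-1) Δ₂) M : ℝ) : ℂ) • φ →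
        ‖star ψ₁ ⬝ᵥ (((∑ x, onSite x (spinRaise 1)) * (∑ y, onSite y (spinLower 1)) : Op V 2) *ᵥ φ)‖ ≤
          ‖star ψ₁' ⬝ᵥ (((∑ x, onSite x (spinRaise 1)) * (∑ y, onSite y (spinLower 1)) : Op V 2) *ᵥ φ)‖

/-- Cauchy–Schwarz for unit vectors, dot-product form: `|⟨φ, ψ⟩| ≤ 1`. [folklore] -/
theorem norm_star_dotProduct_le_one_of_unit {ι : Type*} [Fintype ι] {φ ψ : ι → ℂ}
    (hφ : star φ ⬝ᵥ φ = 1) (hψ : star ψ ⬝ᵥ ψ = 1) : ‖star φ ⬝ᵥ ψ‖ ≤ 1 := by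
  have h1 : star φ ⬝ᵥ ψ = inner ℂ (WithLp.toLp 2 φ : EuclideanSpace ℂ ι) (WithLp.toLp 2 ψ) := by
    rw [EuclideanSpace.inner_eq_star_dotProduct, dotProduct_comm]
  have hn : ∀ x : ι → ℂ, star x ⬝ᵥ x = 1 → ‖(WithLp.toLp 2 x : EuclideanSpace ℂ ι)‖ = 1 := by
    intro x hx
    have h := inner_self_eq_norm_sq_to_K (𝕜 := ℂ) (WithLp.toLp 2 x : EuclideanSpace ℂ ι)
    rw [EuclideanSpace.inner_eq_star_dotProduct, dotProduct_comm] at h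
    have h2 : star x ⬝ᵥ x = ((‖(WithLp.toLp 2 x : EuclideanSpace ℂ ι)‖ : ℝ) : ℂ) ^ 2 := h
    rw [hx, ← Complex.ofReal_pow] at h2
    have h3 : ‖(WithLp.toLp 2 x : EuclideanSpace ℂ ι)‖ ^ 2 = 1 := by exact_mod_cast h2.symm
    nlinarith [norm_nonneg (WithLp.toLp 2 x : EuclideanSpace ℂ ι)]
  rw [h1]
  calc ‖inner ℂ (WithLp.toLp 2 φ : EuclideanSpace ℂ ι) (WithLp.toLp 2 ψ)‖
      ≤ ‖(WithLp.toLp 2 φ : EuclideanSpace ℂ ι)‖ * ‖(WithLp.toLp 2 ψ : EuclideanSpace ℂ ι)‖ :=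
        norm_inner_le_norm _ _
    _ = 1 := by rw [hn φ hφ, hn ψ hψ, one_mul]

/-- **TP-VT ⇒ (OM)** (the theory seat's `overlapMonotone_of_gramTP2`): TP₂ of a kernel with unit
diagonal makes the cosine to a later point non-decreasing (rows `(Δ₁, Δ₁')`, columns `(Δ₁', Δ₂)`,
Cauchy–Schwarz `|⟨ψ₁, ψ₁'⟩| ≤ 1`). [folklore] -/
theorem overlapMonotone_of_gramTP2 (h : VertexTransitiveGroundStateGramTP2) :
    VertexTransitiveOverlapMonotone := by
  intro V _ _ G _ hc hvt M Δ₁ Δ₁' Δ₂ h1 h2 h3 h4 ψ₁ ψ₁' φ g₁m g₁n g₁e g₂m g₂n g₂e g₃m g₃n g₃e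
  have key := h V G hc hvt M Δ₁ Δ₁' Δ₁' Δ₂ h1 h2 (h3.trans h4) (h1.trans h2) h3 h4
    ψ₁ ψ₁' ψ₁' φ g₁m g₁n g₁e g₂m g₂n g₂e g₂m g₂n g₂e g₃m g₃n g₃e
  rw [g₂n, norm_one, mul_one] at key
  have hcs : ‖star ψ₁ ⬝ᵥ ψ₁'‖ ≤ 1 := norm_star_dotProduct_le_one_of_unit g₁n g₂n
  calc ‖star ψ₁ ⬝ᵥ φ‖ ≤ ‖star ψ₁ ⬝ᵥ ψ₁'‖ * ‖star ψ₁' ⬝ᵥ φ‖ := key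
    _ ≤ 1 * ‖star ψ₁' ⬝ᵥ φ‖ := by gcongr
    _ = ‖star ψ₁' ⬝ᵥ φ‖ := one_mul _

end Summit.HubbardSuperconductivity.HubbardSuperconductivity.Theorems.AnisotropyChord
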